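import Summits.AtomisticToContinuum.FouriersLaw.Theses.CoercivePulse
import Summits.AtomisticToContinuum.FouriersLaw.Theorems.HoelderEscapeProfileAbelSpreadCeilingCanonicalTwin
import Literature.MathematicalPhysics.KineticTheory.InfiniteChainShiftInvariantUniqueness
import Literature.MathematicalPhysics.KineticTheory.InfiniteChainSuperstableReversal
import Literature.MathematicalPhysics.KineticTheory.InfiniteChainGoodSetSymmetries
import HarnessLib

/-!
# Negative-lane lemma for crux `CoercivePulse.LinearCeiling` (item stmt-AtomisticToContinuum-15383):
# the a.e. shift-covariance hypothesis is decoration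

`--supports` file (refuter seat `refuter-cdisprove-stmt-AtomisticToContinuum-15383-0`, cycle 1,
2026-08-17); closes nothing, asserts no Theses statement. Theorems only.

Hypothesis mutation finding: the crux's hypothesis
`∀ t, ∀ᵐ σ ∂μ, D.flow t (shift σ) = shift (D.flow t σ)` is DERIVABLE from the others
(`IsChainGibbsMeasure` + `IsShiftInvariant` + `D.PreservesMeasure`), for `ω₂, lam, β > 0`:
every `μ`-preserving dynamics coincides `μ`-a.e. with its canonical Buttà–Marchioro twin
(`AbelSpreadCeiling.RegularityCollapse.stub_canonicalTwin`), whose flow commutes with the lattice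
translations on `bmGood` (`flow_comp_chainShift_ae_of_carrier_eq_bmGood`), and the shift is
`μ`-preserving. Together with the reversal lemma of the sibling file
`LinearCeilingFalseWithoutPreservesMeasure.lean`, this shows that of the crux's structural hypotheses
only `IsChainGibbsMeasure`, `IsShiftInvariant`, `PreservesMeasure` (and the de-junking summability)
carry content — information for provers (`closes` may stop threading the covariance) and planners.
-/

noncomputable section

namespace Summit.AtomisticToContinuum.FouriersLaw.Theorems.LinearCeiling.Negative

open MeasureTheory Filter Set Function
open scoped Topology
open Literature.MathematicalPhysics.KineticTheory.HeatConduction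

/-- **A.e. shift covariance is automatic** for every dynamics preserving the shift-invariant DLR state
of `pinnedChain ω₂ lam β γ` (`ω₂, lam, β > 0`) at `T > 0`: hypothesis `hSh` of
`CoercivePulse.LinearCeiling` (and of its sibling pulse cruxes) is derivable from `IsChainGibbsMeasure`,
`IsShiftInvariant` and `PreservesMeasure`. [cite: ButtaMarchioro2016, §2 Thm 2.1 and eq. (2.6)] -/
theorem shiftCovariant_of_preservesMeasure {ω₂ lam β γ : ℝ} (hω : 0 < ω₂) (hl : 0 < lam) (hβ : 0 < β)
    {T : ℝ} (hT : 0 < T) {μ : Measure ChainConfig}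
    (hG : (pinnedChain ω₂ lam β γ).IsChainGibbsMeasure T μ) (hSI : IsShiftInvariant μ)
    (D : InfiniteChainDynamics (pinnedChain ω₂ lam β γ)) (hP : D.PreservesMeasure μ) (t : ℝ) :
    ∀ᵐ σ ∂μ, D.flow t (shift σ) = shift (D.flow t σ) := by
  -- reversal invariance from uniqueness in the shift-invariant class + superstability
  have hss := OscillatorChain.hasSuperstabilityEstimate_of_isShiftInvariant_pinnedChain γ hω hl.le hβ.le hT
    hG hSI
  have hR : μ.map (fun σ : ChainConfig => fun x : ℤ => ((σ x).1, -(σ x).2)) = μ := by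
    have h := OscillatorChain.map_momentumReversalZ_eq_of_regular_unique hG hSI hss
      (fun μ₁ μ₂ h₁ hS₁ _ h₂ hS₂ _ =>
        OscillatorChain.eq_of_isChainGibbsMeasure_of_isShiftInvariant_pinnedChain γ hω hl.le hβ.le hT
          h₁ hS₁ h₂ hS₂)
    rw [coe_momentumReversalZ] at h
    exact h
  -- the canonical twin and its homogeneity on `bmGood`
  obtain ⟨D', hcar, -, -, hP', hae, -, -⟩ :=
    Summit.AtomisticToContinuum.FouriersLaw.Theorems.AbelSpreadCeiling.RegularityCollapse.stub_canonicalTwin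
      ω₂ lam β γ hω hl hβ T hT μ hG hSI hR D hP
  have hU0 : ∀ r, 0 ≤ (pinnedChain ω₂ lam β γ).U r := OscillatorChain.pinnedChain_U_nonneg β γ hω.le hl.le
  have hV0 : ∀ r, 0 ≤ (pinnedChain ω₂ lam β γ).V r := OscillatorChain.pinnedChain_V_nonneg ω₂ lam γ hβ.le
  have hcomm := D'.flow_comp_chainShift_ae_of_carrier_eq_bmGood hcar hU0 hV0 hP'.1 t 1
  rw [chainShift_one] at hcomm
  have hqmp : Measure.QuasiMeasurePreserving shift μ μ :=
    (⟨shift_measurable, hSI⟩ : MeasurePreserving shift μ μ).quasiMeasurePreserving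
  filter_upwards [hqmp.ae_eq_comp (hae t), hae t, hcomm] with σ h1 h2 h3
  have e1 : D.flow t (shift σ) = D'.flow t (shift σ) := by simpa only [Function.comp_apply] using h1.symm
  have e3 : D'.flow t (shift σ) = shift (D'.flow t σ) := by simpa only [Function.comp_apply] using h3
  rw [e1, e3, h2]

end Summit.AtomisticToContinuum.FouriersLaw.Theorems.LinearCeiling.Negative

end
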